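import Summits.QuantumFields.YangMills.Theorems.SwapVirialDeficitGnomonicDeficitSpeed
import HarnessLib

/-!
# THIRD-ORDER S-B, part J1: 3-JETS OF UNIT QUATERNION PATHS (generic calculus of the Euler remainder `R = F̂ − ½XF̂`)
# (free-hands support of ⟨stmt-QuantumFields-24197⟩ `SwapVirialDeficit.SwapGluedStiffness`)

The virial window row (LW) of ⟨24197⟩ (fcl-p3 g46 memo 2 §3, ✓`swapGluedStiffness_of_leadersValley_and_minus`) carries the remainder
`R = F̂ − ½XF̂`, third order at the flat point along the Euler flow; ✓`Gnomonic.abs_sub_half_flowDeriv_le_of_third` (w2 g57) reduces `|R|` to a bound on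
`|d³/dt³ F̂(eulerDilate t η)|`, `t ∈ [0,1]`, in the LINEAR clock `t`.  The first-order S-B (✓`…GnomonicSpeed/SpeedLeaders/DeficitSpeed/HistorySpeed`)
worked in the exponential clock with speeds bounded by CONSTANTS; the cubic remainder needs bounds that are CUBIC IN THE LETTER SIZES, hence 3-jets.
This file (ring-independent, no chart): the package

  «`f : ℝ → ℍ` carries a 3-jet of size `a`» := `∃ f₁ f₂ f₃, (∀ t, HasDerivAt f (f₁ t) t) ∧ (∀ t, HasDerivAt f₁ (f₂ t) t) ∧ (∀ t, HasDerivAt f₂ (f₃ t) t) ∧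
     ∀ t, ‖f t‖ ≤ 1 ∧ ‖f₁ t‖ ≤ a ∧ ‖f₂ t‖ ≤ a² ∧ ‖f₃ t‖ ≤ 3a³`

(written out in every statement — no `def`), and its closure properties:
* §1 `hasDerivAt_quatStar` (`d/dt f̄ = f̄′`, via ✓`ConstTube.star_eq_two_re`), `norm_mul_le_of_le`;
* §2 ★ `jet3_const`, `jet3_mono`, `jet3_neg`, `jet3_star`, `jet3_smul` (`|c| = 1`), ★★ `jet3_mul` — PRODUCTS ADD SIZES: sizes `a`, `b` give size `a + b`
  (Leibniz to order three; the shape `(a, a², 3a³)` is the smallest product-closed one containing the gnomonic letters of part J2), `jet3_mul3`;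
* §3 real parts: ★ `realJet3_re_term` (`t ↦ c − k·re(w t)`: derivatives `|·| ≤ |k|a, |k|a², 3|k|a³`), `realJet3_add`, `realJet3_const_mul`, ★ `realJet3_sum`
  (finite sums add the bounds) — the bookkeeping shape of ✓`BlowUp.qDeficit`'s coupling ∕ Wilson ∕ seam sums (part J3).
Parts J2 (letters: the radial projection of an affine line has jets `(a, a², 3a³)`, `a = ‖w‖/‖u₀‖`), J3 (`|d³/dt³ qDeficit| ≤ C·L⁴·A³`), J4 (`|R| ≤ C·L⁴·A³`) follow.

HONEST LABEL: elementary calculus (no ring, no measure); nothing about ⟨24197⟩ (window-uniform, OPEN), (LW), (M) or (HM) is proved; ⟨24194⟩ ∕ ⟨24196⟩ ∕ ⟨24497⟩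
OPEN; item of record ⟨24085⟩ SubOctaveBounded aside ∕ untouched; no crux, rung of record or summit is proved; the Yang–Mills mass gap is NOT proved; no summit is
proved by a line.  THEOREMS ONLY (0 `def`, 0 `sorry`), standard axioms, no local instances.  Seat ym-line-fcl-p3 g47 (cell ym-idea-1, free hands),
`--supports stmt-QuantumFields-24197`.  References: [folklore] (Leibniz rule).
-/

set_option autoImplicit false

noncomputable section

open Quaternion
open scoped Quaternion BigOperators

namespace Summit.QuantumFields.YangMills.Theorems.SwapVirialDeficit.Gnomonic

/-! ## §1 Calculus helpers -/

/-- `d/dt f̄ = (f′)‾` for a quaternion path (`q̄ = 2re(q)·1 − q`, ✓`ConstTube.star_eq_two_re`). [folklore] -/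
theorem hasDerivAt_quatStar {f : ℝ → ℍ} {f' : ℍ} {t : ℝ} (h : HasDerivAt f f' t) : HasDerivAt (fun t => star (f t)) (star f') t := by
  have h1 := (((hasDerivAt_re h).const_mul 2).smul_const (1 : ℍ)).sub h
  have e : (fun s => star (f s)) = fun s => (2 * (f s).re) • (1 : ℍ) - f s :=
    funext fun s => FemtoTransferGap.TwoLattice.ConstTube.star_eq_two_re _
  rw [e, FemtoTransferGap.TwoLattice.ConstTube.star_eq_two_re]
  exact h1

/-- `‖x·y‖ ≤ c·d` from `‖x‖ ≤ c`, `‖y‖ ≤ d`, `0 ≤ c`. [folklore] -/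
theorem norm_mul_le_of_le {x y : ℍ} {c d : ℝ} (hx : ‖x‖ ≤ c) (hy : ‖y‖ ≤ d) (hc : 0 ≤ c) : ‖x * y‖ ≤ c * d :=
  (norm_mul_le x y).trans (mul_le_mul hx hy (norm_nonneg _) hc)

/-! ## §2 The 3-jet package and its closure properties -/

/-- ★ A constant path of norm `≤ 1` carries a 3-jet of every size `a ≥ 0`. [folklore] -/
theorem jet3_const (q : ℍ) (hq : ‖q‖ ≤ 1) {a : ℝ} (ha : 0 ≤ a) :
    ∃ f₁ f₂ f₃ : ℝ → ℍ, (∀ t, HasDerivAt (fun _ : ℝ => q) (f₁ t) t) ∧ (∀ t, HasDerivAt f₁ (f₂ t) t) ∧ (∀ t, HasDerivAt f₂ (f₃ t) t) ∧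
      ∀ t, ‖q‖ ≤ 1 ∧ ‖f₁ t‖ ≤ a ∧ ‖f₂ t‖ ≤ a ^ 2 ∧ ‖f₃ t‖ ≤ 3 * a ^ 3 :=
  ⟨fun _ => 0, fun _ => 0, fun _ => 0, fun t => hasDerivAt_const t q, fun t => hasDerivAt_const t 0, fun t => hasDerivAt_const t 0,
    fun _ => ⟨hq, by simpa using ha, by simp; positivity, by simp; positivity⟩⟩

/-- ★ Monotonicity in the size: a 3-jet of size `a ≥ 0` is a 3-jet of every size `b ≥ a`. [folklore] -/
theorem jet3_mono {f : ℝ → ℍ} {a b : ℝ} (ha : 0 ≤ a) (hab : a ≤ b)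
    (hf : ∃ f₁ f₂ f₃ : ℝ → ℍ, (∀ t, HasDerivAt f (f₁ t) t) ∧ (∀ t, HasDerivAt f₁ (f₂ t) t) ∧ (∀ t, HasDerivAt f₂ (f₃ t) t) ∧
      ∀ t, ‖f t‖ ≤ 1 ∧ ‖f₁ t‖ ≤ a ∧ ‖f₂ t‖ ≤ a ^ 2 ∧ ‖f₃ t‖ ≤ 3 * a ^ 3) :
    ∃ f₁ f₂ f₃ : ℝ → ℍ, (∀ t, HasDerivAt f (f₁ t) t) ∧ (∀ t, HasDerivAt f₁ (f₂ t) t) ∧ (∀ t, HasDerivAt f₂ (f₃ t) t) ∧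
      ∀ t, ‖f t‖ ≤ 1 ∧ ‖f₁ t‖ ≤ b ∧ ‖f₂ t‖ ≤ b ^ 2 ∧ ‖f₃ t‖ ≤ 3 * b ^ 3 := by
  obtain ⟨f₁, f₂, f₃, h₁, h₂, h₃, hb⟩ := hf
  refine ⟨f₁, f₂, f₃, h₁, h₂, h₃, fun t => ⟨(hb t).1, (hb t).2.1.trans hab, (hb t).2.2.1.trans (pow_le_pow_left₀ ha hab 2),
    (hb t).2.2.2.trans (by nlinarith [pow_le_pow_left₀ ha hab 3])⟩⟩

/-- ★ Negation preserves 3-jets. [folklore] -/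
theorem jet3_neg {f : ℝ → ℍ} {a : ℝ}
    (hf : ∃ f₁ f₂ f₃ : ℝ → ℍ, (∀ t, HasDerivAt f (f₁ t) t) ∧ (∀ t, HasDerivAt f₁ (f₂ t) t) ∧ (∀ t, HasDerivAt f₂ (f₃ t) t) ∧
      ∀ t, ‖f t‖ ≤ 1 ∧ ‖f₁ t‖ ≤ a ∧ ‖f₂ t‖ ≤ a ^ 2 ∧ ‖f₃ t‖ ≤ 3 * a ^ 3) :
    ∃ g₁ g₂ g₃ : ℝ → ℍ, (∀ t, HasDerivAt (fun t => -f t) (g₁ t) t) ∧ (∀ t, HasDerivAt g₁ (g₂ t) t) ∧ (∀ t, HasDerivAt g₂ (g₃ t) t) ∧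
      ∀ t, ‖-f t‖ ≤ 1 ∧ ‖g₁ t‖ ≤ a ∧ ‖g₂ t‖ ≤ a ^ 2 ∧ ‖g₃ t‖ ≤ 3 * a ^ 3 := by
  obtain ⟨f₁, f₂, f₃, h₁, h₂, h₃, hb⟩ := hf
  refine ⟨fun t => -f₁ t, fun t => -f₂ t, fun t => -f₃ t, fun t => (h₁ t).neg, fun t => (h₂ t).neg, fun t => (h₃ t).neg, fun t => ?_⟩
  simp only [norm_neg]; exact hb t

/-- ★ Conjugation preserves 3-jets (`‖q̄‖ = ‖q‖`). [folklore] -/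
theorem jet3_star {f : ℝ → ℍ} {a : ℝ}
    (hf : ∃ f₁ f₂ f₃ : ℝ → ℍ, (∀ t, HasDerivAt f (f₁ t) t) ∧ (∀ t, HasDerivAt f₁ (f₂ t) t) ∧ (∀ t, HasDerivAt f₂ (f₃ t) t) ∧
      ∀ t, ‖f t‖ ≤ 1 ∧ ‖f₁ t‖ ≤ a ∧ ‖f₂ t‖ ≤ a ^ 2 ∧ ‖f₃ t‖ ≤ 3 * a ^ 3) :
    ∃ g₁ g₂ g₃ : ℝ → ℍ, (∀ t, HasDerivAt (fun t => star (f t)) (g₁ t) t) ∧ (∀ t, HasDerivAt g₁ (g₂ t) t) ∧ (∀ t, HasDerivAt g₂ (g₃ t) t) ∧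
      ∀ t, ‖star (f t)‖ ≤ 1 ∧ ‖g₁ t‖ ≤ a ∧ ‖g₂ t‖ ≤ a ^ 2 ∧ ‖g₃ t‖ ≤ 3 * a ^ 3 := by
  obtain ⟨f₁, f₂, f₃, h₁, h₂, h₃, hb⟩ := hf
  refine ⟨fun t => star (f₁ t), fun t => star (f₂ t), fun t => star (f₃ t), fun t => hasDerivAt_quatStar (h₁ t),
    fun t => hasDerivAt_quatStar (h₂ t), fun t => hasDerivAt_quatStar (h₃ t), fun t => ?_⟩
  simp only [Quaternion.norm_star]; exact hb t

/-- ★ A real sign `c`, `|c| = 1`, preserves 3-jets (`c • f`; the hemisphere signs of ✓`gnoLetter`). [folklore] -/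
theorem jet3_smul {f : ℝ → ℍ} {a c : ℝ} (hc : |c| = 1)
    (hf : ∃ f₁ f₂ f₃ : ℝ → ℍ, (∀ t, HasDerivAt f (f₁ t) t) ∧ (∀ t, HasDerivAt f₁ (f₂ t) t) ∧ (∀ t, HasDerivAt f₂ (f₃ t) t) ∧
      ∀ t, ‖f t‖ ≤ 1 ∧ ‖f₁ t‖ ≤ a ∧ ‖f₂ t‖ ≤ a ^ 2 ∧ ‖f₃ t‖ ≤ 3 * a ^ 3) :
    ∃ g₁ g₂ g₃ : ℝ → ℍ, (∀ t, HasDerivAt (fun t => c • f t) (g₁ t) t) ∧ (∀ t, HasDerivAt g₁ (g₂ t) t) ∧ (∀ t, HasDerivAt g₂ (g₃ t) t) ∧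
      ∀ t, ‖c • f t‖ ≤ 1 ∧ ‖g₁ t‖ ≤ a ∧ ‖g₂ t‖ ≤ a ^ 2 ∧ ‖g₃ t‖ ≤ 3 * a ^ 3 := by
  obtain ⟨f₁, f₂, f₃, h₁, h₂, h₃, hb⟩ := hf
  refine ⟨fun t => c • f₁ t, fun t => c • f₂ t, fun t => c • f₃ t, fun t => (h₁ t).const_smul c, fun t => (h₂ t).const_smul c,
    fun t => (h₃ t).const_smul c, fun t => ?_⟩
  simp only [norm_smul, Real.norm_eq_abs, hc, one_mul]; exact hb t

/-- ★★ **PRODUCTS ADD SIZES** (Leibniz to order three): if `f`, `g` carry 3-jets of sizes `a, b ≥ 0` then `f·g` carries a 3-jet of size `a + b` —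
first `a + b`, second `a² + 2ab + b² = (a+b)²`, third `3a³ + 3a²b + 3ab² + 3b³ ≤ 3(a+b)³`. [folklore] -/
theorem jet3_mul {f g : ℝ → ℍ} {a b : ℝ} (ha : 0 ≤ a) (hb : 0 ≤ b)
    (hf : ∃ f₁ f₂ f₃ : ℝ → ℍ, (∀ t, HasDerivAt f (f₁ t) t) ∧ (∀ t, HasDerivAt f₁ (f₂ t) t) ∧ (∀ t, HasDerivAt f₂ (f₃ t) t) ∧
      ∀ t, ‖f t‖ ≤ 1 ∧ ‖f₁ t‖ ≤ a ∧ ‖f₂ t‖ ≤ a ^ 2 ∧ ‖f₃ t‖ ≤ 3 * a ^ 3)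
    (hg : ∃ g₁ g₂ g₃ : ℝ → ℍ, (∀ t, HasDerivAt g (g₁ t) t) ∧ (∀ t, HasDerivAt g₁ (g₂ t) t) ∧ (∀ t, HasDerivAt g₂ (g₃ t) t) ∧
      ∀ t, ‖g t‖ ≤ 1 ∧ ‖g₁ t‖ ≤ b ∧ ‖g₂ t‖ ≤ b ^ 2 ∧ ‖g₃ t‖ ≤ 3 * b ^ 3) :
    ∃ p₁ p₂ p₃ : ℝ → ℍ, (∀ t, HasDerivAt (fun t => f t * g t) (p₁ t) t) ∧ (∀ t, HasDerivAt p₁ (p₂ t) t) ∧ (∀ t, HasDerivAt p₂ (p₃ t) t) ∧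
      ∀ t, ‖f t * g t‖ ≤ 1 ∧ ‖p₁ t‖ ≤ a + b ∧ ‖p₂ t‖ ≤ (a + b) ^ 2 ∧ ‖p₃ t‖ ≤ 3 * (a + b) ^ 3 := by
  obtain ⟨f₁, f₂, f₃, hf₁, hf₂, hf₃, nf⟩ := hf
  obtain ⟨g₁, g₂, g₃, hg₁, hg₂, hg₃, ng⟩ := hg
  refine ⟨fun t => f₁ t * g t + f t * g₁ t,
    fun t => (f₂ t * g t + f₁ t * g₁ t) + (f₁ t * g₁ t + f t * g₂ t),
    fun t => ((f₃ t * g t + f₂ t * g₁ t) + (f₂ t * g₁ t + f₁ t * g₂ t)) + ((f₂ t * g₁ t + f₁ t * g₂ t) + (f₁ t * g₂ t + f t * g₃ t)),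
    fun t => (hf₁ t).mul (hg₁ t),
    fun t => ((hf₂ t).mul (hg₁ t)).add ((hf₁ t).mul (hg₂ t)),
    fun t => (((hf₃ t).mul (hg₁ t)).add ((hf₂ t).mul (hg₂ t))).add (((hf₂ t).mul (hg₂ t)).add ((hf₁ t).mul (hg₃ t))),
    fun t => ?_⟩
  obtain ⟨n0, n1, n2, n3⟩ := nf t
  obtain ⟨m0, m1, m2, m3⟩ := ng t
  have ha2 : 0 ≤ a ^ 2 := by positivity
  have ha3 : 0 ≤ 3 * a ^ 3 := by positivity
  have e00 := norm_mul_le_of_le n0 m0 zero_le_one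
  have e10 := norm_mul_le_of_le n1 m0 ha
  have e01 := norm_mul_le_of_le n0 m1 zero_le_one
  have e20 := norm_mul_le_of_le n2 m0 ha2
  have e11 := norm_mul_le_of_le n1 m1 ha
  have e02 := norm_mul_le_of_le n0 m2 zero_le_one
  have e30 := norm_mul_le_of_le n3 m0 ha3
  have e21 := norm_mul_le_of_le n2 m1 ha2
  have e12 := norm_mul_le_of_le n1 m2 ha
  have e03 := norm_mul_le_of_le n0 m3 zero_le_one
  refine ⟨by simpa using e00, ?_, ?_, ?_⟩
  · calc ‖f₁ t * g t + f t * g₁ t‖ ≤ ‖f₁ t * g t‖ + ‖f t * g₁ t‖ := norm_add_le _ _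
      _ ≤ a * 1 + 1 * b := add_le_add e10 e01
      _ = a + b := by ring
  · calc ‖(f₂ t * g t + f₁ t * g₁ t) + (f₁ t * g₁ t + f t * g₂ t)‖
        ≤ (‖f₂ t * g t‖ + ‖f₁ t * g₁ t‖) + (‖f₁ t * g₁ t‖ + ‖f t * g₂ t‖) :=
          (norm_add_le _ _).trans (add_le_add (norm_add_le _ _) (norm_add_le _ _))
      _ ≤ (a ^ 2 * 1 + a * b) + (a * b + 1 * b ^ 2) := add_le_add (add_le_add e20 e11) (add_le_add e11 e02)
      _ = (a + b) ^ 2 := by ring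
  · calc ‖((f₃ t * g t + f₂ t * g₁ t) + (f₂ t * g₁ t + f₁ t * g₂ t)) + ((f₂ t * g₁ t + f₁ t * g₂ t) + (f₁ t * g₂ t + f t * g₃ t))‖
        ≤ ((‖f₃ t * g t‖ + ‖f₂ t * g₁ t‖) + (‖f₂ t * g₁ t‖ + ‖f₁ t * g₂ t‖)) + ((‖f₂ t * g₁ t‖ + ‖f₁ t * g₂ t‖) + (‖f₁ t * g₂ t‖ + ‖f t * g₃ t‖)) :=
          (norm_add_le _ _).trans (add_le_add ((norm_add_le _ _).trans (add_le_add (norm_add_le _ _) (norm_add_le _ _)))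
            ((norm_add_le _ _).trans (add_le_add (norm_add_le _ _) (norm_add_le _ _))))
      _ ≤ ((3 * a ^ 3 * 1 + a ^ 2 * b) + (a ^ 2 * b + a * b ^ 2)) + ((a ^ 2 * b + a * b ^ 2) + (a * b ^ 2 + 1 * (3 * b ^ 3))) :=
          add_le_add (add_le_add (add_le_add e30 e21) (add_le_add e21 e12)) (add_le_add (add_le_add e21 e12) (add_le_add e12 e03))
      _ ≤ 3 * (a + b) ^ 3 := by nlinarith [mul_nonneg (mul_nonneg ha ha) hb, mul_nonneg (mul_nonneg ha hb) hb]

/-- ★ Three factors: sizes `a, b, c` give size `a + b + c` (the shape of the ring's links: words of at most three letters). [folklore] -/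
theorem jet3_mul3 {f g h : ℝ → ℍ} {a b c : ℝ} (ha : 0 ≤ a) (hb : 0 ≤ b) (hc : 0 ≤ c)
    (hf : ∃ f₁ f₂ f₃ : ℝ → ℍ, (∀ t, HasDerivAt f (f₁ t) t) ∧ (∀ t, HasDerivAt f₁ (f₂ t) t) ∧ (∀ t, HasDerivAt f₂ (f₃ t) t) ∧
      ∀ t, ‖f t‖ ≤ 1 ∧ ‖f₁ t‖ ≤ a ∧ ‖f₂ t‖ ≤ a ^ 2 ∧ ‖f₃ t‖ ≤ 3 * a ^ 3)
    (hg : ∃ g₁ g₂ g₃ : ℝ → ℍ, (∀ t, HasDerivAt g (g₁ t) t) ∧ (∀ t, HasDerivAt g₁ (g₂ t) t) ∧ (∀ t, HasDerivAt g₂ (g₃ t) t) ∧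
      ∀ t, ‖g t‖ ≤ 1 ∧ ‖g₁ t‖ ≤ b ∧ ‖g₂ t‖ ≤ b ^ 2 ∧ ‖g₃ t‖ ≤ 3 * b ^ 3)
    (hh : ∃ h₁ h₂ h₃ : ℝ → ℍ, (∀ t, HasDerivAt h (h₁ t) t) ∧ (∀ t, HasDerivAt h₁ (h₂ t) t) ∧ (∀ t, HasDerivAt h₂ (h₃ t) t) ∧
      ∀ t, ‖h t‖ ≤ 1 ∧ ‖h₁ t‖ ≤ c ∧ ‖h₂ t‖ ≤ c ^ 2 ∧ ‖h₃ t‖ ≤ 3 * c ^ 3) :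
    ∃ p₁ p₂ p₃ : ℝ → ℍ, (∀ t, HasDerivAt (fun t => f t * g t * h t) (p₁ t) t) ∧ (∀ t, HasDerivAt p₁ (p₂ t) t) ∧ (∀ t, HasDerivAt p₂ (p₃ t) t) ∧
      ∀ t, ‖f t * g t * h t‖ ≤ 1 ∧ ‖p₁ t‖ ≤ a + b + c ∧ ‖p₂ t‖ ≤ (a + b + c) ^ 2 ∧ ‖p₃ t‖ ≤ 3 * (a + b + c) ^ 3 :=
  jet3_mul (f := fun t => f t * g t) (add_nonneg ha hb) hc (jet3_mul ha hb hf hg) hh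

/-! ## §3 Real parts and finite sums -/

/-- ★ **The real term `c − k·re(w(t))`** along a path `w` carrying a 3-jet of size `a`: three derivatives, bounded by `|k|·a`, `|k|·a²`, `|k|·3a³`
(`|re q| ≤ ‖q‖`, ✓`abs_re_le_norm`). [folklore] -/
theorem realJet3_re_term {w : ℝ → ℍ} {a : ℝ} (c k : ℝ)
    (hw : ∃ w₁ w₂ w₃ : ℝ → ℍ, (∀ t, HasDerivAt w (w₁ t) t) ∧ (∀ t, HasDerivAt w₁ (w₂ t) t) ∧ (∀ t, HasDerivAt w₂ (w₃ t) t) ∧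
      ∀ t, ‖w t‖ ≤ 1 ∧ ‖w₁ t‖ ≤ a ∧ ‖w₂ t‖ ≤ a ^ 2 ∧ ‖w₃ t‖ ≤ 3 * a ^ 3) :
    ∃ d₁ d₂ d₃ : ℝ → ℝ, (∀ t, HasDerivAt (fun t => c - k * (w t).re) (d₁ t) t) ∧ (∀ t, HasDerivAt d₁ (d₂ t) t) ∧ (∀ t, HasDerivAt d₂ (d₃ t) t) ∧
      ∀ t, |d₁ t| ≤ |k| * a ∧ |d₂ t| ≤ |k| * a ^ 2 ∧ |d₃ t| ≤ |k| * (3 * a ^ 3) := by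
  obtain ⟨w₁, w₂, w₃, h₁, h₂, h₃, hb⟩ := hw
  refine ⟨fun t => -(k * (w₁ t).re), fun t => -(k * (w₂ t).re), fun t => -(k * (w₃ t).re), fun t => ?_, fun t => ?_, fun t => ?_, fun t => ?_⟩
  · have h := ((hasDerivAt_re (h₁ t)).const_mul k).const_sub c
    simpa using h
  · exact ((hasDerivAt_re (h₂ t)).const_mul k).neg
  · exact ((hasDerivAt_re (h₃ t)).const_mul k).neg
  · have r1 := (Literature.MathematicalPhysics.QuantumLattice.abs_re_le_norm (w₁ t)).trans (hb t).2.1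
    have r2 := (Literature.MathematicalPhysics.QuantumLattice.abs_re_le_norm (w₂ t)).trans (hb t).2.2.1
    have r3 := (Literature.MathematicalPhysics.QuantumLattice.abs_re_le_norm (w₃ t)).trans (hb t).2.2.2
    simp only [abs_neg, abs_mul]
    exact ⟨mul_le_mul_of_nonneg_left r1 (abs_nonneg k), mul_le_mul_of_nonneg_left r2 (abs_nonneg k), mul_le_mul_of_nonneg_left r3 (abs_nonneg k)⟩

/-- ★ Sums of two real 3-jets: the bounds add. [folklore] -/
theorem realJet3_add {φ ψ : ℝ → ℝ} {M₁ M₂ M₃ N₁ N₂ N₃ : ℝ}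
    (hφ : ∃ d₁ d₂ d₃ : ℝ → ℝ, (∀ t, HasDerivAt φ (d₁ t) t) ∧ (∀ t, HasDerivAt d₁ (d₂ t) t) ∧ (∀ t, HasDerivAt d₂ (d₃ t) t) ∧
      ∀ t, |d₁ t| ≤ M₁ ∧ |d₂ t| ≤ M₂ ∧ |d₃ t| ≤ M₃)
    (hψ : ∃ d₁ d₂ d₃ : ℝ → ℝ, (∀ t, HasDerivAt ψ (d₁ t) t) ∧ (∀ t, HasDerivAt d₁ (d₂ t) t) ∧ (∀ t, HasDerivAt d₂ (d₃ t) t) ∧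
      ∀ t, |d₁ t| ≤ N₁ ∧ |d₂ t| ≤ N₂ ∧ |d₃ t| ≤ N₃) :
    ∃ d₁ d₂ d₃ : ℝ → ℝ, (∀ t, HasDerivAt (fun t => φ t + ψ t) (d₁ t) t) ∧ (∀ t, HasDerivAt d₁ (d₂ t) t) ∧ (∀ t, HasDerivAt d₂ (d₃ t) t) ∧
      ∀ t, |d₁ t| ≤ M₁ + N₁ ∧ |d₂ t| ≤ M₂ + N₂ ∧ |d₃ t| ≤ M₃ + N₃ := by
  obtain ⟨p₁, p₂, p₃, hp₁, hp₂, hp₃, bp⟩ := hφ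
  obtain ⟨q₁, q₂, q₃, hq₁, hq₂, hq₃, bq⟩ := hψ
  refine ⟨fun t => p₁ t + q₁ t, fun t => p₂ t + q₂ t, fun t => p₃ t + q₃ t, fun t => (hp₁ t).add (hq₁ t), fun t => (hp₂ t).add (hq₂ t),
    fun t => (hp₃ t).add (hq₃ t), fun t => ⟨?_, ?_, ?_⟩⟩
  · exact (abs_add_le _ _).trans (add_le_add (bp t).1 (bq t).1)
  · exact (abs_add_le _ _).trans (add_le_add (bp t).2.1 (bq t).2.1)
  · exact (abs_add_le _ _).trans (add_le_add (bp t).2.2 (bq t).2.2)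

/-- ★ A constant multiple of a real 3-jet. [folklore] -/
theorem realJet3_const_mul {φ : ℝ → ℝ} {M₁ M₂ M₃ : ℝ} (k : ℝ)
    (hφ : ∃ d₁ d₂ d₃ : ℝ → ℝ, (∀ t, HasDerivAt φ (d₁ t) t) ∧ (∀ t, HasDerivAt d₁ (d₂ t) t) ∧ (∀ t, HasDerivAt d₂ (d₃ t) t) ∧
      ∀ t, |d₁ t| ≤ M₁ ∧ |d₂ t| ≤ M₂ ∧ |d₃ t| ≤ M₃) :
    ∃ d₁ d₂ d₃ : ℝ → ℝ, (∀ t, HasDerivAt (fun t => k * φ t) (d₁ t) t) ∧ (∀ t, HasDerivAt d₁ (d₂ t) t) ∧ (∀ t, HasDerivAt d₂ (d₃ t) t) ∧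
      ∀ t, |d₁ t| ≤ |k| * M₁ ∧ |d₂ t| ≤ |k| * M₂ ∧ |d₃ t| ≤ |k| * M₃ := by
  obtain ⟨p₁, p₂, p₃, hp₁, hp₂, hp₃, bp⟩ := hφ
  refine ⟨fun t => k * p₁ t, fun t => k * p₂ t, fun t => k * p₃ t, fun t => (hp₁ t).const_mul k, fun t => (hp₂ t).const_mul k,
    fun t => (hp₃ t).const_mul k, fun t => ?_⟩
  simp only [abs_mul]
  exact ⟨mul_le_mul_of_nonneg_left (bp t).1 (abs_nonneg k), mul_le_mul_of_nonneg_left (bp t).2.1 (abs_nonneg k),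
    mul_le_mul_of_nonneg_left (bp t).2.2 (abs_nonneg k)⟩

/-- ★ **FINITE SUMS ADD THE BOUNDS**: if every `φ i` carries a real 3-jet with bounds `M₁ i, M₂ i, M₃ i`, then `t ↦ Σ_i φ i t` carries one with bounds
`Σ M₁, Σ M₂, Σ M₃` (✓`HasDerivAt.fun_sum`). [folklore] -/
theorem realJet3_sum {ι : Type*} [Fintype ι] {φ : ι → ℝ → ℝ} {M₁ M₂ M₃ : ι → ℝ}
    (h : ∀ i, ∃ d₁ d₂ d₃ : ℝ → ℝ, (∀ t, HasDerivAt (φ i) (d₁ t) t) ∧ (∀ t, HasDerivAt d₁ (d₂ t) t) ∧ (∀ t, HasDerivAt d₂ (d₃ t) t) ∧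
      ∀ t, |d₁ t| ≤ M₁ i ∧ |d₂ t| ≤ M₂ i ∧ |d₃ t| ≤ M₃ i) :
    ∃ d₁ d₂ d₃ : ℝ → ℝ, (∀ t, HasDerivAt (fun t => ∑ i, φ i t) (d₁ t) t) ∧ (∀ t, HasDerivAt d₁ (d₂ t) t) ∧ (∀ t, HasDerivAt d₂ (d₃ t) t) ∧
      ∀ t, |d₁ t| ≤ ∑ i, M₁ i ∧ |d₂ t| ≤ ∑ i, M₂ i ∧ |d₃ t| ≤ ∑ i, M₃ i := by
  choose d₁ d₂ d₃ h₁ h₂ h₃ hb using h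
  refine ⟨fun t => ∑ i, d₁ i t, fun t => ∑ i, d₂ i t, fun t => ∑ i, d₃ i t, fun t => ?_, fun t => ?_, fun t => ?_, fun t => ⟨?_, ?_, ?_⟩⟩
  · have hs := HasDerivAt.fun_sum (u := Finset.univ) fun i _ => h₁ i t
    simpa using hs
  · have hs := HasDerivAt.fun_sum (u := Finset.univ) fun i _ => h₂ i t
    convert hs using 1
  · have hs := HasDerivAt.fun_sum (u := Finset.univ) fun i _ => h₃ i t
    convert hs using 1
  · exact (Finset.abs_sum_le_sum_abs _ _).trans (Finset.sum_le_sum fun i _ => (hb i t).1)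
  · exact (Finset.abs_sum_le_sum_abs _ _).trans (Finset.sum_le_sum fun i _ => (hb i t).2.1)
  · exact (Finset.abs_sum_le_sum_abs _ _).trans (Finset.sum_le_sum fun i _ => (hb i t).2.2)

end Summit.QuantumFields.YangMills.Theorems.SwapVirialDeficit.Gnomonic

end
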